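import Summits.CriticalPhenomena.CardyFormulaZ2.Theses.CardyBoundaryCoulombGas
import Summits.CriticalPhenomena.CardyFormulaZ2.Theorems.CardyBoundaryCoulombGasStripClusterRatesReduction
import Summits.CriticalPhenomena.CardyFormulaZ2.Theorems.CardyBoundaryCoulombGasStripClusterRatesModulusUnique
import Summits.CriticalPhenomena.CardyFormulaZ2.Theorems.StripClusterRates.Negative.WidthOneTwoClusterExact
import Literature.Probability.LatticeModels.RowStatePlanar

/-!
# The width-one instance of `stub_relaxIsBethe` (line `two-cluster-rate-is-stationary-gap`, crux `StripClusterRates`)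

Stub `stub_relaxIsBethe` (BI₂) of the skeleton asserts, for every width `n ≥ 1`, that the RELAXATION MODULUS
of width `n` — the second-largest eigenvalue modulus of the unmarked (stochastic) block of the planar `⋆`-chain
`planarTransfer (Finset.Icc 0 n)` — equals the Bethe eigenvalue
`Λ_n(w) = 2^{-(2n+1)} ∏_j (4 sinh² w_j + 2)/(4 sinh² w_j + 2 - √3)` at every ordered positive ground-state
solution `w : Fin (n-1) → ℝ` of the staggered open-chain Bethe equations with `N = 2n+2` strands.

At `n = 1` there are no roots (`M = 0`): the product is empty and the assertion reads `s = 1/8`. This instance is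
a THEOREM of the tree: by the landed reduction `twoClusterRate_eq_relaxationRate` the relaxation modulus of
width `1` is `e^{-γ₂(1)}` for the two-cluster rate `γ₂(1)`, which is `3 log 2` by the landed exact computation
`Negative.rateTwo_width_one`; so it is `e^{-3 log 2} = 1/8`, and the relaxation modulus is unique
(`bi_relaxationModulus_unique`). No Bethe-ansatz input is needed at this width.

* `bi2_relaxationModulus_width_one` — every relaxation modulus of width `1` equals `1/8`;
* `bi2_relaxIsBethe_width_one` — the statement of `stub_relaxIsBethe` with `n` replaced by `1` (registered helper).
-/

noncomputable section

namespace Summit.CriticalPhenomena.CardyFormulaZ2.Cruxes.StripClusterRates.TwoClusterRateIsStationaryGap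

open Filter Topology
open scoped BigOperators Classical
open Literature.Probability.Percolation Literature.Probability.LatticeModels

/-- `e^{-3 log 2} = 1/8`. [folklore] -/
theorem bi2_exp_neg_three_log_two : Real.exp (-(3 * Real.log 2)) = 1 / 8 := by
  rw [Real.exp_neg, show (3 : ℝ) * Real.log 2 = Real.log (2 ^ 3) by rw [Real.log_pow]; norm_num,
    Real.exp_log (by norm_num)]
  norm_num

/-- **The relaxation modulus of width one is `1/8`.** The two-cluster rate of width `1` exists and its
exponential is a relaxation modulus (`twoClusterRate_eq_relaxationRate`); the rate is `3 log 2`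
(`Negative.rateTwo_width_one`, uniqueness of limits); relaxation moduli are unique
(`bi_relaxationModulus_unique`). [folklore] -/
theorem bi2_relaxationModulus_width_one :
    ∀ s : ℝ,
      ((∃ (μ : ℂ) (v : PlanarRowState (Finset.Icc (0 : ℤ) 1) → ℂ),
          (v ≠ 0 ∧ (∀ p, (∃ x, p.1.JoinedToStar x) → v p = 0) ∧
            ∀ p, (∀ x, ¬ p.1.JoinedToStar x) →
              ∑ q, (planarTransfer (Finset.Icc (0 : ℤ) 1) p q : ℂ) * v q = μ * v p) ∧
          μ ≠ 1 ∧ ‖μ‖ = s) ∧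
        ∀ (μ : ℂ) (v : PlanarRowState (Finset.Icc (0 : ℤ) 1) → ℂ),
          (v ≠ 0 ∧ (∀ p, (∃ x, p.1.JoinedToStar x) → v p = 0) ∧
            ∀ p, (∀ x, ¬ p.1.JoinedToStar x) →
              ∑ q, (planarTransfer (Finset.Icc (0 : ℤ) 1) p q : ℂ) * v q = μ * v p) →
          μ ≠ 1 → ‖μ‖ ≤ s) →
      s = 1 / 8 := by
  intro s hs
  obtain ⟨γ, hγ, hmod⟩ := twoClusterRate_eq_relaxationRate 1 le_rfl
  have hγ3 : γ = 3 * Real.log 2 :=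
    Summit.CriticalPhenomena.CardyFormulaZ2.Theorems.StripClusterRates.Negative.rateTwo_width_one_unique hγ
  have h8 : Real.exp (-γ) = 1 / 8 := by rw [hγ3]; exact bi2_exp_neg_three_log_two
  rw [← h8]
  exact bi_relaxationModulus_unique 1 s (Real.exp (-γ)) hs hmod

/-- **BI₂ at width one** — the statement of the registered stub `stub_relaxIsBethe` with `n` replaced by `1`:
the relaxation modulus of width `1` equals the (empty-product, `M = 1 - 1 = 0` roots) Bethe eigenvalue
`Λ_1 = 1 / 2 ^ 3`, for every (vacuous) ground-state Bethe datum `w : Fin (1 - 1) → ℝ`. [folklore] -/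
theorem bi2_relaxIsBethe_width_one :
    ∀ s : ℝ,
      ((∃ (μ : ℂ) (v : PlanarRowState (Finset.Icc (0 : ℤ) 1) → ℂ),
          (v ≠ 0 ∧ (∀ p, (∃ x, p.1.JoinedToStar x) → v p = 0) ∧
            ∀ p, (∀ x, ¬ p.1.JoinedToStar x) →
              ∑ q, (planarTransfer (Finset.Icc (0 : ℤ) 1) p q : ℂ) * v q = μ * v p) ∧
          μ ≠ 1 ∧ ‖μ‖ = s) ∧
        ∀ (μ : ℂ) (v : PlanarRowState (Finset.Icc (0 : ℤ) 1) → ℂ),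
          (v ≠ 0 ∧ (∀ p, (∃ x, p.1.JoinedToStar x) → v p = 0) ∧
            ∀ p, (∀ x, ¬ p.1.JoinedToStar x) →
              ∑ q, (planarTransfer (Finset.Icc (0 : ℤ) 1) p q : ℂ) * v q = μ * v p) →
          μ ≠ 1 → ‖μ‖ ≤ s) →
      ∀ w : Fin (1 - 1) → ℝ,
        (StrictMono w ∧ (∀ j, 0 < w j) ∧
          ∀ j : Fin (1 - 1), ((2 * 1 + 2 : ℕ) : ℝ) *
              (Real.arctan ((2 + Real.sqrt 3) * Real.tanh (w j)) + Real.arctan (Real.tanh (w j))) -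
            ∑ l ∈ Finset.univ.erase j,
              (Real.arctan (Real.tanh (w j - w l) / Real.sqrt 3) + Real.arctan (Real.tanh (w j + w l) / Real.sqrt 3)) =
            Real.pi * ((j : ℕ) + 1)) →
        s = (∏ j, (4 * Real.sinh (w j) ^ 2 + 2) / (4 * Real.sinh (w j) ^ 2 + 2 - Real.sqrt 3)) / 2 ^ (2 * 1 + 1) := by
  intro s hs w _hw
  rw [bi2_relaxationModulus_width_one s hs]
  have huniv : (Finset.univ : Finset (Fin (1 - 1))) = ∅ := rfl
  rw [huniv, Finset.prod_empty]
  norm_num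

end Summit.CriticalPhenomena.CardyFormulaZ2.Cruxes.StripClusterRates.TwoClusterRateIsStationaryGap

end
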